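/-
Copyright (c) 2026. All rights reserved.
Released under Apache 2.0 license as described in the file LICENSE.
-/
import Literature.AlgebraicGeometry.ComplexMultiplication.HyperellipticJacobianFourTimesPrimeQuadraticSubfieldMultiplicities
import HarnessLib

/-!
# `E_i × Y_{4p}` (`p ≡ 3 (mod 4)`) is of WEIL TYPE for `k = ℚ(i)` at the level of CM types: multiplicities `((p+1)/4, (p+1)/4)` — F44's exceptional class sits in the Weil codimension

Family `hodge`, cell `pub-hodgecm2` (COR-CM), KEPT Literature lane `lit-deligne-3` (generation 55, file F49; sequel of F44 (the exceptional class on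
`E_i × Y_{4p}`, `i ∈ L_{4p}`) and F48 (`ℚ(i)` on `Ψ_{4p}`: multiplicities `((p+1)/4, (p−3)/4)`)).  THEOREMS ONLY: no definition, no named fact,
no `sorry`, no instance; D-0026 net debt `0`.  Nothing here asserts the algebraicity of any class; HC_CM is NOT proved.

THE POINT.  An abelian variety `X` of dimension `g` with an imaginary quadratic field `k ↪ End⁰(X)` acting on `T_{X,0}` with multiplicities
`(g/2, g/2)` is «of Weil type»; its space of Weil classes `W_k = ⋀^{g}_k H¹(X, ℚ) ⊂ H^{g}(X, ℚ)` consists of Hodge classes of codimension `g/2`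
(Weil 1977; van Geemen 1994 §5; Moonen–Zarhin 1999 (1.9) and §5 Case 2: «There is an embedding `k ↪ End⁰(Z)` such that `k` acts on `T_{Z,0}` with
multiplicities `(3,3)`. This implies that the corresponding space of Weil classes `W_k ⊂ H⁶(Z, ℚ)` consists of Hodge classes»).  For the infinite family
`E_i × Y_{4p}` (`p ≡ 3 (mod 4)` prime; `g = (p+1)/2`) of F44: embed `k = ℚ(i)` into `End⁰(E_i) × End⁰(Y_{4p}) ⊇ ℚ(ζ_4) × L_{4p}` by
`i ↦ (ζ̄_4, ζ_{4p}^p)` — complex CONJUGATE on the curve.  On the CM types: `Φ_4 = {σ₁}` sends `ζ̄_4 = ζ_4³ ↦ −e^{2πi/4}` (§1), and `Ψ_{4p}` sends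
`ζ_{4p}^p ↦ +e^{2πi/4}` for `(p+1)/4` of its members and `↦ −e^{2πi/4}` for `(p−3)/4` (F48).  Total: **`(p+1)/4` and `1 + (p−3)/4 = (p+1)/4` — EQUAL:
`E_i × Y_{4p}` is of Weil type for `k = ℚ(i)`**, and its Weil classes live in codimension `g/2 = (p+1)/4` — exactly the codimension of F44's exceptional
class (`p = 7`: Moonen–Zarhin's case (a)(1), `B•` generated by `D•` and `W_k ⊂ B²`; `p = 11`: a sixfold of Weil type with an exceptional class in `H⁶`).

WHAT IS PROVED.
* §1 **`ncard_cmType_level_four`** — the lower-half type of `ℚ(ζ_4)` is the single embedding of exponent `1`: `#{σ ∈ Φ_4 : σ(ζ_4³) = e^{2πi/4}} = 0`,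
  `#{σ ∈ Φ_4 : σ(ζ_4³) = −e^{2πi/4}} = 1` (private: `e^{2πi/4p}` to the `p` is `e^{2πi/4}`, whose square is `−1`).
* §2 **`weilType_multiplicities_cmCurve_oddSimpleFactor`** — `p ≡ 3 (mod 4)` prime, `Φ_4`, `Φ_{4p}` lower-half types, `(L; Ψ)` an index-`2` sub-pair
  with `Ψ^K = Φ_{4p}` and `ζ_{4p}^p ∈ L`: `∃ c` (`c² = −1`) with `#{σ ∈ Φ_4 : σ(ζ_4³) = c} + #{ρ ∈ Ψ : ρ(ζ^p) = c} = (p+1)/4` and the same for `−c`.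

HONEST.  CM-TYPE LEVEL ONLY: the tree's Hodge-structure notion `Motives.…IsOfWeilType` (an `EndAction` of `k` on `H¹` with equal multiplicities)
is NOT instantiated here — that needs the realisations' `θ`-actions on `H¹(E_i) ⊕ H¹(Y_{4p})` (not typed in this lane); nor is F44's class shown to lie
in the Weil space `W_k`.  The algebraicity of Weil classes (Schoen, van Geemen; Markman: abelian fourfolds of Weil type and sixfolds of split Weil type
[Markman2025SurveySecant, Thm. 1.2]) is NOT applied and nothing is claimed about it.  No numerics.

## References
* [MoonenZarhin1999LowDim] B. Moonen, Yu. Zarhin, Math. Ann. 315 (1999): Introduction (a), Thm. 0.1 (1), (1.9), §5 Case 2 [corpus: paper:arxiv-math_9901113 pp. 1, 10].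
  [cite: MoonenZarhin1999LowDim, Introduction (a), Thm. 0.1 (1) and §5 Case 2]
* [vanGeemen1994HodgeAV] B. van Geemen, LNM 1594 (1994), §5 (abelian varieties of Weil type). [cite: vanGeemen1994HodgeAV, §5]
* [Markman2025SurveySecant] E. Markman, *Secant sheaves and Weil classes on abelian varieties* (2025), Thm. 1.2 — context only. [cite: Markman2025SurveySecant, Thm. 1.2]
* [GalleseGoodsonLombardo2024] Gallese–Goodson–Lombardo, §3 Thm. 3.0 (5), §3.2 Lemma 11. [cite: GalleseGoodsonLombardo2024, §3 Thm. 3.0 (5) and §3.2 Lemma 11]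
* [Washington1997] L. C. Washington, Thm. 2.5. [cite: Washington1997, Thm. 2.5]
* [MumfordAV1970] D. Mumford, *Abelian Varieties*, §22. [cite: MumfordAV1970, §22]
-/

open CategoryTheory CategoryTheory.Limits NumberField Module

namespace Literature.AlgebraicGeometry.ComplexMultiplication

open Literature.AlgebraicGeometry.Motives
open Literature.NumberTheory.ComplexMultiplication

namespace HyperellipticJacobian

open Literature.AlgebraicGeometry.Pohlmann1968 Literature.AlgebraicGeometry.Pohlmann1968.Cyclotomic
open Literature.AlgebraicGeometry.Pohlmann1968.CMAlgebra

/-! ## §1 The member `E_i`: `ℚ(ζ_4)` with its lower-half type `{σ : e(σ) = 1}` -/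

section LevelFour

variable {N₀ : ℕ} [NeZero N₀] {K₀ : Type} [Field K₀] [NumberField K₀] [IsCyclotomicExtension {N₀} ℚ K₀]

/-- `e^{2πi/4p}` raised to `p` is `e^{2πi/4}`: the values `σ₀(ζ_{4p}^p)` and `σ(ζ_4)` (exponent `1`) are the same complex number `i`. [folklore] -/
private theorem rootζ_four_mul_pow {p : ℕ} (hp : 0 < p) : rootζ (4 * p) ^ p = rootζ 4 := by
  rw [rootζ, rootζ, ← Complex.exp_nat_mul]
  congr 1
  have hp' : (p : ℂ) ≠ 0 := Nat.cast_ne_zero.2 hp.ne'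
  push_cast
  field_simp

/-- `(e^{2πi/4})² = −1`. [folklore] -/
private theorem rootζ_four_sq : rootζ 4 ^ 2 = -1 := by
  have hμ : IsPrimitiveRoot (rootζ 4) 4 := by simpa [rootζ] using Complex.isPrimitiveRoot_exp 4 (by norm_num)
  exact (hμ.pow (by norm_num) (show 4 = 2 * 2 by rfl)).eq_neg_one_of_two_right

/-- **The lower-half type of `ℚ(ζ_4) = ℚ(i)` is the single embedding of exponent `1`**, which sends `ζ_4 ↦ e^{2πi/4}` and `ζ_4³ = ζ̄_4 ↦ −e^{2πi/4}`:
`#{σ ∈ Φ_4 : σ(ζ_4³) = e^{2πi/4}} = 0`, `#{σ ∈ Φ_4 : σ(ζ_4³) = −e^{2πi/4}} = 1`. [cite: Washington1997, Thm. 2.5] [cite: MumfordAV1970, §22 (CM elliptic curves)] -/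
theorem ncard_cmType_level_four (hN : N₀ = 4) (Φ₀ : CMType K₀) (hΦ : ∀ σ : K₀ →+* ℂ, σ ∈ Φ₀.1 ↔ 2 * (expOf N₀ K₀ σ).val < N₀) :
    {σ | σ ∈ Φ₀.1 ∧ σ (zetaOf N₀ K₀ ^ 3) = rootζ 4}.ncard = 0 ∧ {σ | σ ∈ Φ₀.1 ∧ σ (zetaOf N₀ K₀ ^ 3) = -rootζ 4}.ncard = 1 := by
  subst hN
  have hμ0 : rootζ 4 ≠ 0 := by rw [rootζ]; exact Complex.exp_ne_zero _
  -- every member of `Φ₀` has exponent `1`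
  have he : ∀ σ : K₀ →+* ℂ, σ ∈ Φ₀.1 ↔ (expOf 4 K₀ σ).val = 1 := fun σ => by
    rw [hΦ]
    have hcop := coprime_expOf 4 K₀ σ
    have hlt := ZMod.val_lt (expOf 4 K₀ σ)
    constructor
    · intro h
      have hv : (expOf 4 K₀ σ).val < 2 := by omega
      interval_cases hh : (expOf 4 K₀ σ).val
      · exact absurd hcop (by decide)
      · rfl
    · intro h; rw [h]; norm_num
  have hval : ∀ σ : K₀ →+* ℂ, σ ∈ Φ₀.1 → σ (zetaOf 4 K₀ ^ 3) = -rootζ 4 := fun σ hσ => by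
    rw [map_pow, expOf_spec 4 K₀ σ, (he σ).1 hσ, pow_one, pow_succ, rootζ_four_sq, neg_one_mul]
  obtain ⟨σ₁, hσ₁⟩ := exists_expOf_eq 4 K₀ (1 : ZMod 4) (by decide)
  have h1 : (expOf 4 K₀ σ₁).val = 1 := by rw [hσ₁]; rfl
  refine ⟨?_, ?_⟩
  · rw [Set.ncard_eq_zero]
    ext σ
    simp only [Set.mem_setOf_eq, Set.mem_empty_iff_false, iff_false, not_and]
    intro hσ h
    rw [hval σ hσ] at h
    apply hμ0
    linear_combination -h / 2
  · rw [Set.ncard_eq_one]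
    refine ⟨σ₁, ?_⟩
    ext σ
    simp only [Set.mem_setOf_eq, Set.mem_singleton_iff]
    constructor
    · rintro ⟨hσ, -⟩
      exact expOf_injective 4 K₀ (ZMod.val_injective 4 (((he σ).1 hσ).trans h1.symm))
    · intro hσ
      rw [hσ]
      exact ⟨(he σ₁).2 h1, hval σ₁ ((he σ₁).2 h1)⟩

end LevelFour

/-! ## §2 `E_i × Y_{4p}` (`p ≡ 3 (mod 4)`): `k = ℚ(i)`, embedded as `i ↦ (ζ̄_4, ζ_{4p}^p)`, acts on the CM type with multiplicities `((p+1)/4, (p+1)/4)` -/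

section WeilType

variable {N₀ : ℕ} [NeZero N₀] {K₀ : Type} [Field K₀] [NumberField K₀] [IsCyclotomicExtension {N₀} ℚ K₀]
  {N : ℕ} [NeZero N] {K : Type} [Field K] [NumberField K] [IsCyclotomicExtension {N} ℚ K]

/-- Counting through a 2-to-1 restriction: `#{σ ∈ Ψ^K : σ(x) = c} = 2 · #{ρ ∈ Ψ : ρ(x) = c}` for `x ∈ L`, `[K : L] = 2`.
[cite: Shimura1998, §6.2 Thm. 3 (proof)] -/
private theorem ncard_eq_two_mul_ncard'' {L : IntermediateField ℚ K} {Ψ : CMType L} {Φ : CMType K}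
    (hind : inducedCMType (algebraMap L K) Ψ = Φ) (hfin : Module.finrank L K = 2) (x : L) (c : ℂ) :
    {σ : K →+* ℂ | σ ∈ Φ.1 ∧ σ (x : K) = c}.ncard = 2 * {ρ : L →+* ℂ | ρ ∈ Ψ.1 ∧ ρ x = c}.ncard := by
  classical
  have h := card_filter_comp_mem (K := K) (L := L) (Finset.univ.filter fun ρ : L →+* ℂ => ρ ∈ Ψ.1 ∧ ρ x = c)
  rw [hfin] at h
  have e1 : {σ : K →+* ℂ | σ ∈ Φ.1 ∧ σ (x : K) = c} = ↑(Finset.univ.filter fun σ : K →+* ℂ =>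
      σ.comp (algebraMap L K) ∈ (Finset.univ.filter fun ρ : L →+* ℂ => ρ ∈ Ψ.1 ∧ ρ x = c)) := by
    ext σ
    simp only [Set.mem_setOf_eq, Finset.coe_filter, Finset.mem_filter, Finset.mem_univ, true_and, RingHom.coe_comp,
      Function.comp_apply, ← hind, mem_inducedCMType_iff]
    rfl
  have e2 : {ρ : L →+* ℂ | ρ ∈ Ψ.1 ∧ ρ x = c} = ↑(Finset.univ.filter fun ρ : L →+* ℂ => ρ ∈ Ψ.1 ∧ ρ x = c) := by
    ext ρ
    simp only [Set.mem_setOf_eq, Finset.coe_filter, Finset.mem_univ, true_and]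
  rw [e1, e2, Set.ncard_coe_finset, Set.ncard_coe_finset, h]

/-- **`E_i × Y_{4p}` IS OF WEIL TYPE FOR `k = ℚ(i)` AT THE LEVEL OF CM TYPES** (`p ≡ 3 (mod 4)` prime).  With the CM type `Φ_4` of `E_i`
(`ℚ(ζ_4)`, lower half) and the CM type `(L; Ψ)` of the simple `(p−1)/2`-fold `Y_{4p}` (index-`2` sub-pair of `(ℚ(ζ_{4p}); Φ_{4p})` with
`i_Y = ζ_{4p}^p ∈ L`, F44 §5), embed `k = ℚ(i)` into `ℚ(ζ_4) × L` by `i ↦ (ζ_4³, ζ_{4p}^p) = (ζ̄_4, i_Y)` (conjugate on the curve).  Then the value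
`c = e^{2πi/4}` (`c² = −1`) is taken by EXACTLY `(p+1)/4` members of the type `Φ_4 ⊔ Ψ` and `−c` by EXACTLY `(p+1)/4` members:
`#{σ ∈ Φ_4 : σ(ζ_4³) = c} + #{ρ ∈ Ψ : ρ(i_Y) = c} = 0 + (p+1)/4` and `#{σ ∈ Φ_4 : σ(ζ_4³) = −c} + #{ρ ∈ Ψ : ρ(i_Y) = −c} = 1 + (p−3)/4` — EQUAL
multiplicities `(g/2, g/2)`, `g = dim(E_i × Y_{4p}) = (p+1)/2`: the Weil-type condition for `k` on `E_i × Y_{4p}`, whose Weil classes sit in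
`H^{g}` — codimension `g/2 = (p+1)/4`, exactly where F44 located the exceptional class.  (`p = 7`: Moonen–Zarhin's case (a), `B•` generated by
`D•` and `W_k ⊂ B²`.)  [cite: MoonenZarhin1999LowDim, Introduction (a) and Thm. 0.1 (1)] [cite: vanGeemen1994HodgeAV, §5 (Weil type)]
[cite: GalleseGoodsonLombardo2024, §3 Thm. 3.0 (5) and §3.2 Lemma 11] [cite: Washington1997, Thm. 2.5] -/
theorem weilType_multiplicities_cmCurve_oddSimpleFactor {p : ℕ} (hp : p.Prime) (hp3 : p % 4 = 3) (hN₀ : N₀ = 4) (hN : N = 4 * p)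
    (Φ₀ : CMType K₀) (hΦ₀ : ∀ σ : K₀ →+* ℂ, σ ∈ Φ₀.1 ↔ 2 * (expOf N₀ K₀ σ).val < N₀)
    (Φ : CMType K) (hΦ : ∀ σ : K →+* ℂ, σ ∈ Φ.1 ↔ 2 * (expOf N K σ).val < N)
    {L : IntermediateField ℚ K} {Ψ : CMType L} (hind : inducedCMType (algebraMap L K) Ψ = Φ) (hfin : Module.finrank L K = 2)
    (hi : zetaOf N K ^ p ∈ L) :
    ∃ c : ℂ, c ^ 2 = -1 ∧
      {σ | σ ∈ Φ₀.1 ∧ σ (zetaOf N₀ K₀ ^ 3) = c}.ncard + {ρ | ρ ∈ Ψ.1 ∧ ρ ⟨_, hi⟩ = c}.ncard = (p + 1) / 4 ∧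
      {σ | σ ∈ Φ₀.1 ∧ σ (zetaOf N₀ K₀ ^ 3) = -c}.ncard + {ρ | ρ ∈ Ψ.1 ∧ ρ ⟨_, hi⟩ = -c}.ncard = (p + 1) / 4 := by
  obtain ⟨h0, h1'⟩ := ncard_cmType_level_four hN₀ Φ₀ hΦ₀
  -- the `Ψ`-side counts, read on `K` through the 2-to-1 restriction, relative to the value `σ₀'(ζ_{4p}^p) = e^{2πi/4}`
  have hplus := ncard_eq_two_mul_ncard'' hind hfin ⟨_, hi⟩ (rootζ 4)
  have hminus := ncard_eq_two_mul_ncard'' hind hfin ⟨_, hi⟩ (-rootζ 4)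
  obtain ⟨σ₀', hσ₀', h1σ, hP, hM⟩ := exists_multiplicities_of_level_fourMulPrime_three_mod_four hp hp3 hN Φ hΦ
  have hc' : σ₀' (zetaOf N K ^ p) = rootζ 4 := by
    subst hN
    rw [map_pow, expOf_spec (4 * p) K σ₀', h1σ, pow_one, rootζ_four_mul_pow hp.pos]
  rw [hc'] at hP hM
  have eP : {σ : K →+* ℂ | σ ∈ Φ.1 ∧ σ ((⟨_, hi⟩ : L) : K) = rootζ 4} = {σ | σ ∈ Φ.1 ∧ σ (zetaOf N K ^ p) = rootζ 4} := rfl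
  have eM : {σ : K →+* ℂ | σ ∈ Φ.1 ∧ σ ((⟨_, hi⟩ : L) : K) = -rootζ 4} = {σ | σ ∈ Φ.1 ∧ σ (zetaOf N K ^ p) = -rootζ 4} := rfl
  rw [eP, hP] at hplus
  rw [eM, hM] at hminus
  refine ⟨rootζ 4, rootζ_four_sq, ?_, ?_⟩
  · rw [h0]; omega
  · rw [h1']; omega

end WeilType

end HyperellipticJacobian

end Literature.AlgebraicGeometry.ComplexMultiplication
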